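import Mathlib
import HarnessLib
import Summits.AtomisticToContinuum.FouriersLaw.Theses.JunctionLocality
import Summits.AtomisticToContinuum.FouriersLaw.Theorems.JunctionLocalitySuperadditiveResistanceKuboFrame
import Summits.AtomisticToContinuum.FouriersLaw.Theorems.JunctionLocalitySuperadditiveResistanceStubKuboFrameAux1
import Summits.AtomisticToContinuum.FouriersLaw.Theorems.JunctionLocalitySuperadditiveResistanceStubJunctionCurvaturePairings

/-!
# Junction curvature of the probed END fields, III: the energy-channel split and the reduction of the stub
(stub `stub_junctionCurvature` of line `thermalise-then-cut-probe-insertion`, crux `JunctionLocality.SuperadditiveResistance`,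
stmt-AtomisticToContinuum-11748; helper file, `--supports`)

The stub (skeleton v3): `∃ C₃ ∀ N, M ≥ 2 ∀ KuboFrame P T N M g gb₁ gb₄`, `curvature gb₁ ≤ C₃ (selfLeft g)²` and
`curvature gb₄ ≤ C₃ (selfRight g)²`, `curvature f = ‖S_K f‖²_{L²(μ_T)}`. Its `N`-uniform content is in no engine of
the tree or of the literature; this file proves the EXACT FIXED-`N` IDENTITY that isolates it and the resulting
equivalence with two named `N`-uniform bounds, nothing taken as a hypothesis:

* `curvature_sub_const_mul_eK`, `curvature_eq_energyChannel_add` — for ANY `f ∈ C²` with `f, S_K f ∈ L²(μ_T)`: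
  `‖S_K f‖² = ⟨f, φ⟩²/T² + ‖S_K(f − (⟨f,φ⟩/2) e_K)‖²`, `φ = (p²_{N−1} − T) + (p²_N − T)` — the orthogonal split of
  `S_K f` along the pair's first even Hermite mode (`S_K φ = −2φ`, `‖φ‖² = 4T²`): ENERGY CHANNEL + curvature of the
  field corrected by the pair's local-equilibrium shift `e_K = (p²_{N−1} + p²_N)/(2T²)` (the same shift that enters
  `stub_junctionRoughness` as `θ e_K`);
* `kuboFrame_pairPairing` — the Kubo rows of the frame read `⟨gb₁, φ⟩ = (T²/γ²) transferLeft g`, `⟨gb₄, φ⟩ = (T²/γ²) transferRight g`;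
* `helper_curvatureEnergyChannel` (registered) — hence, under `KuboFrame`,
  `curvature gb₁ = T²(transferLeft g)²/γ⁴ + curvature(gb₁ − (T² transferLeft g/(2γ²)) e_K)` and the mirror at bath 4;
  the first summand is the known floor (`energyChannel_le_curvature_of_kuboFrame`; in the refuter's exact Gaussian beds it
  is `T²(u/a)²/γ⁴ ≤ 1` of the measured `C3 = ‖S_K gb₁‖²/a² ≈ 3.8–4.4`, the rest being the direction channel);
* `helper_curvatureChannelReduction` (registered) and `channelBounds_of_stub_junctionCurvature` — the stub is EQUIVALENT,
  frame by frame, to the conjunction of two `N`-uniform bounds: (i) the Kubo-COEFFICIENT inequality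
  `(transferLeft g)² ≤ C (selfLeft g)²`, i.e. `|selfLeft g − bypass g| ≤ √C · selfLeft g` (the bypass `g₀₃` two-sidedly
  controlled by the end self-conductance — note the LOWER bound on the bypass it contains), and (ii) the DIRECTION-CHANNEL
  bound `‖S_K(gb₁ − (T² transferLeft g/(2γ²)) e_K)‖² ≤ C (selfLeft g)²` (plus mirrors); constants `C₃ = (T²/γ⁴ + 1)C`,
  conversely `C = max(γ⁴C₃/T², C₃)`.

Parts I–II: `…StubJunctionCurvaturePairings` (the `S_K`-pairings), `…StubJunctionCurvatureDirichlet` (free `N`-uniform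
first-derivative budget `T Σ_{pair} ‖∂_p gb₁‖² ≤ (T²/γ³)(γ − selfLeft g)`). No definitions; standard axioms; folklore
Gaussian calculus.
-/

noncomputable section

open MeasureTheory Filter Topology ProbabilityTheory
open scoped ContDiff NNReal ENNReal
open Literature.MathematicalPhysics.KineticTheory.HeatConduction

namespace Summit.AtomisticToContinuum.FouriersLaw.Cruxes.SuperadditiveResistance.ThermaliseThenCutProbeInsertion

open Summit.AtomisticToContinuum.FouriersLaw.Theorems.SuperadditiveResistance
open Summit.AtomisticToContinuum.FouriersLaw.Theorems.SuperadditiveResistance.Kubo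
  (fluctuation_dissipation memLp_partialP memLp_kinetic memLp_momentum gauss_ibp integrable_mul_mul_gibbsDensity
    integrable_sq_mul_gibbsDensity integrable_mul_gibbsDensity_iff integral_sq_mul_gibbsDensity_eq)
open Summit.AtomisticToContinuum.FouriersLaw.Theorems.SuperadditiveResistance.DeviceLiouville
  (liouvilleOp bathOp deviceWeight deviceGenerator_eq kin_eq_sq partialP_sub differentiable_partialP_of_contDiff_two)

section EnergyChannel

variable {ω₂ lam β γ : ℝ} {N M : ℕ}

open Summit.AtomisticToContinuum.FouriersLaw.Cruxes.SuperadditiveResistance.InsertionToolbox.Assembly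
  (contDiff_eK memLp_eK)

/-- **Shifting a field along the local-equilibrium direction `e_K` (exact, any `C²` field).** For `f ∈ C²` with
`f, S_K f ∈ L²(μ_T)` and every `c : ℝ`:
`‖S_K(f − c·e_K)‖² = ‖S_K f‖² − (4c/T²)⟨f, (p²_{N−1} − T) + (p²_N − T)⟩ + 4c²/T²`
(`S_K e_K = −φ/T²`, `⟨S_K f, φ⟩ = ⟨f, S_K φ⟩ = −2⟨f, φ⟩`, `‖φ‖² = 4T²`, `φ = (p²_{N−1} − T) + (p²_N − T)`). -/
theorem curvature_sub_const_mul_eK (hω : 0 < ω₂) (hl : 0 ≤ lam) (hβ : 0 ≤ β) (γ : ℝ) {T : ℝ} (hT : 0 < T)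
    (hN : 1 ≤ N) (hM : 1 ≤ M) {f : PhaseSpace (N + M) → ℝ} (hfC : ContDiff ℝ 2 f)
    (hfL2 : MemLp f 2 ((pinnedChain ω₂ lam β γ).gibbsMeasure (N + M) T))
    (hSf : MemLp (junctionOU T N M f) 2 ((pinnedChain ω₂ lam β γ).gibbsMeasure (N + M) T)) (c : ℝ) :
    curvature (pinnedChain ω₂ lam β γ) T N M (fun x => f x - c * eK T N M x) =
      curvature (pinnedChain ω₂ lam β γ) T N M f -
        4 * c / T ^ 2 * (∫ x, f x * ((kin (N + M) (N - 1) x - T) + (kin (N + M) N x - T))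
          ∂((pinnedChain ω₂ lam β γ).gibbsMeasure (N + M) T)) + 4 * c ^ 2 / T ^ 2 := by
  haveI := pinnedChain_isProbabilityMeasure_gibbsMeasure hω hl hβ γ (N + M) hT
  set μ := (pinnedChain ω₂ lam β γ).gibbsMeasure (N + M) T with hμ
  set φ : PhaseSpace (N + M) → ℝ := fun x => (kin (N + M) (N - 1) x - T) + (kin (N + M) N x - T) with hφ
  set S : PhaseSpace (N + M) → ℝ := junctionOU T N M f with hS
  have hT2 : T ^ 2 ≠ 0 := pow_ne_zero 2 hT.ne'
  -- pointwise: `S_K e_K = −φ/T²`, `S_K (f − c e_K) = S_K f + (c/T²) φ`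
  have hSE : ∀ x, junctionOU T N M (eK T N M) x = -(1 / T ^ 2) * φ x := by
    intro x
    rw [junctionOU_eK hN hM hT.ne']
    simp only [hφ]
    field_simp
    ring
  have hE : ContDiff ℝ 2 (eK T N M) := contDiff_eK T
  have hpt : ∀ x, junctionOU T N M (fun y => f y - c * eK T N M y) x = S x + c / T ^ 2 * φ x := by
    intro x
    rw [junctionOU_sub_const_mul hfC hE c x, hSE x]
    simp only [hS]
    ring
  have eφ : ∀ x, φ x = 2 * T ^ 2 * eK T N M x - 2 * T := by
    intro x
    simp only [hφ, eK]
    field_simp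
    ring
  -- `L²` bookkeeping
  have hφL2 : MemLp φ 2 μ :=
    (memLp_kin_sub_line hω hl hβ γ (s := N - 1) (by omega) hT).add (memLp_kin_sub_line hω hl hβ γ (s := N) (by omega) hT)
  have hI_SS : Integrable (fun x => S x ^ 2) μ := hSf.integrable_sq
  have hI_Sφ : Integrable (fun x => S x * φ x) μ := hSf.integrable_mul hφL2
  have hI_φφ : Integrable (fun x => φ x ^ 2) μ := hφL2.integrable_sq
  have hI_SE : Integrable (fun x => S x * eK T N M x) μ := hSf.integrable_mul (memLp_eK hω hl hβ γ N M hT)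
  have hI_S : Integrable S μ := hSf.integrable one_le_two
  have hI_fφ : Integrable (fun x => f x * φ x) μ := hfL2.integrable_mul hφL2
  -- `⟨S_K f, φ⟩ = −2 ⟨f, φ⟩`
  have hSφ : ∫ x, S x * φ x ∂μ = -2 * ∫ x, f x * φ x ∂μ := by
    have h1 := integral_junctionOU_mul_eK hω hl hβ γ hT hN hM hfC hfL2 hSf
    have h0 := integral_junctionOU_eq_zero hω hl hβ γ hT hfC hfL2 hSf
    have e1 : (fun x => S x * φ x) = fun x => 2 * T ^ 2 * (S x * eK T N M x) - 2 * T * S x := by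
      funext x; rw [eφ x]; ring
    rw [e1, integral_sub (hI_SE.const_mul _) (hI_S.const_mul _), integral_const_mul, integral_const_mul]
    have e2 : (fun x => f x * ((2 * T - kin (N + M) (N - 1) x - kin (N + M) N x) / T ^ 2)) =
        fun x => (-(1 / T ^ 2)) * (f x * φ x) := by
      funext x
      simp only [hφ]
      field_simp
      ring
    have h1' : ∫ x, S x * eK T N M x ∂μ = -(1 / T ^ 2) * ∫ x, f x * φ x ∂μ := by
      simp only [hS]
      rw [h1, e2, integral_const_mul]
    have h0' : ∫ x, S x ∂μ = 0 := h0
    rw [h1', h0']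
    field_simp
    ring
  have hφφ : ∫ x, φ x ^ 2 ∂μ = 4 * T ^ 2 := integral_kinPair_sq hω hl hβ γ hT hN hM
  -- expand the square
  have hexp : ∫ x, (S x + c / T ^ 2 * φ x) ^ 2 ∂μ =
      (∫ x, S x ^ 2 ∂μ) + 2 * (c / T ^ 2) * (∫ x, S x * φ x ∂μ) + (c / T ^ 2) ^ 2 * ∫ x, φ x ^ 2 ∂μ := by
    have e : (fun x => (S x + c / T ^ 2 * φ x) ^ 2) = fun x =>
        S x ^ 2 + 2 * (c / T ^ 2) * (S x * φ x) + (c / T ^ 2) ^ 2 * φ x ^ 2 := by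
      funext x; ring
    have I12 : Integrable (fun x => S x ^ 2 + 2 * (c / T ^ 2) * (S x * φ x)) μ := hI_SS.add (hI_Sφ.const_mul _)
    rw [e, integral_add I12 (hI_φφ.const_mul _), integral_add hI_SS (hI_Sφ.const_mul _), integral_const_mul,
      integral_const_mul]
  unfold curvature
  simp_rw [hpt]
  rw [hexp, hSφ, hφφ]
  simp only [hS, hφ]
  field_simp
  ring

/-- **ENERGY CHANNEL OF THE JUNCTION CURVATURE (exact Pythagoras, fixed `N`, `M`; any `C²` field).** For the
pinned chain at `T > 0` (`N, M ≥ 1`) and every `f ∈ C²` with `f, S_K f ∈ L²(μ_T)`: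

  `‖S_K f‖² = ⟨f, φ⟩²/T² + ‖S_K (f − (⟨f, φ⟩/2)·e_K)‖²`,  `φ = (p²_{N−1} − T) + (p²_N − T)`,

the orthogonal split of `S_K f` along the first even Hermite mode `φ` of the pair (`S_K φ = −2φ`): the ENERGY
CHANNEL `⟨f, φ⟩²/T²` (how much of `f` is a Gibbs shift of the pair's kinetic temperature) plus the curvature of
the LTE-corrected field `f − (⟨f,φ⟩/2) e_K`, which carries no `φ`-component. For the device's END forward field
`⟨gb₁, φ⟩ = (T²/γ²)·transferLeft g` (Kubo rows), see `helper_curvatureEnergyChannel`. -/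
theorem curvature_eq_energyChannel_add (hω : 0 < ω₂) (hl : 0 ≤ lam) (hβ : 0 ≤ β) (γ : ℝ) {T : ℝ} (hT : 0 < T)
    (hN : 1 ≤ N) (hM : 1 ≤ M) {f : PhaseSpace (N + M) → ℝ} (hfC : ContDiff ℝ 2 f)
    (hfL2 : MemLp f 2 ((pinnedChain ω₂ lam β γ).gibbsMeasure (N + M) T))
    (hSf : MemLp (junctionOU T N M f) 2 ((pinnedChain ω₂ lam β γ).gibbsMeasure (N + M) T)) :
    curvature (pinnedChain ω₂ lam β γ) T N M f =
      (∫ x, f x * ((kin (N + M) (N - 1) x - T) + (kin (N + M) N x - T))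
          ∂((pinnedChain ω₂ lam β γ).gibbsMeasure (N + M) T)) ^ 2 / T ^ 2 +
      curvature (pinnedChain ω₂ lam β γ) T N M (fun x => f x -
        (∫ y, f y * ((kin (N + M) (N - 1) y - T) + (kin (N + M) N y - T))
          ∂((pinnedChain ω₂ lam β γ).gibbsMeasure (N + M) T)) / 2 * eK T N M x) := by
  rw [curvature_sub_const_mul_eK hω hl hβ γ hT hN hM hfC hfL2 hSf]
  have hT2 : T ^ 2 ≠ 0 := pow_ne_zero 2 hT.ne'
  field_simp
  ring

/-- **The energy channel is a floor**: `⟨f, φ⟩²/T² ≤ ‖S_K f‖²` (the second summand is a curvature, `≥ 0`). -/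
theorem energyChannel_le_curvature (hω : 0 < ω₂) (hl : 0 ≤ lam) (hβ : 0 ≤ β) (γ : ℝ) {T : ℝ} (hT : 0 < T)
    (hN : 1 ≤ N) (hM : 1 ≤ M) {f : PhaseSpace (N + M) → ℝ} (hfC : ContDiff ℝ 2 f)
    (hfL2 : MemLp f 2 ((pinnedChain ω₂ lam β γ).gibbsMeasure (N + M) T))
    (hSf : MemLp (junctionOU T N M f) 2 ((pinnedChain ω₂ lam β γ).gibbsMeasure (N + M) T)) :
    (∫ x, f x * ((kin (N + M) (N - 1) x - T) + (kin (N + M) N x - T))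
        ∂((pinnedChain ω₂ lam β γ).gibbsMeasure (N + M) T)) ^ 2 / T ^ 2 ≤
      curvature (pinnedChain ω₂ lam β γ) T N M f := by
  rw [curvature_eq_energyChannel_add hω hl hβ γ hT hN hM hfC hfL2 hSf]
  have : 0 ≤ curvature (pinnedChain ω₂ lam β γ) T N M (fun x => f x -
      (∫ y, f y * ((kin (N + M) (N - 1) y - T) + (kin (N + M) N y - T))
        ∂((pinnedChain ω₂ lam β γ).gibbsMeasure (N + M) T)) / 2 * eK T N M x) :=
    integral_nonneg fun _ => sq_nonneg _
  linarith

/-- Kubo rows of the END fields read the pair pairing: `⟨gb₁, φ⟩ = (T²/γ²)·transferLeft g`,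
`⟨gb₄, φ⟩ = (T²/γ²)·transferRight g` under `KuboFrame` (`γ, T ≠ 0`). -/
theorem kuboFrame_pairPairing {ω₂ lam β γ T : ℝ} (hω : 0 < ω₂) (hl : 0 ≤ lam) (hβ : 0 ≤ β) (hγ : 0 < γ)
    (hT : 0 < T) {N M : ℕ} (hN : 1 ≤ N) (hM : 1 ≤ M) {g : Fin 4 → Fin 4 → ℝ} {gb₁ gb₄ : PhaseSpace (N + M) → ℝ}
    (hKF : KuboFrame (pinnedChain ω₂ lam β γ) T N M g gb₁ gb₄) :
    ∫ x, gb₁ x * ((kin (N + M) (N - 1) x - T) + (kin (N + M) N x - T)) ∂((pinnedChain ω₂ lam β γ).gibbsMeasure (N + M) T) =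
      T ^ 2 / γ ^ 2 * transferLeft g ∧
    ∫ x, gb₄ x * ((kin (N + M) (N - 1) x - T) + (kin (N + M) N x - T)) ∂((pinnedChain ω₂ lam β γ).gibbsMeasure (N + M) T) =
      T ^ 2 / γ ^ 2 * transferRight g := by
  obtain ⟨hsym, -, hff1, hff4, hK1, -, hK4, -⟩ := hKF
  obtain ⟨-, h1L2, -, -, -⟩ := hff1
  obtain ⟨-, h4L2, -, -, -⟩ := hff4
  set μ := (pinnedChain ω₂ lam β γ).gibbsMeasure (N + M) T with hμ
  have hPγ : (pinnedChain ω₂ lam β γ).γ = γ := rfl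
  have hka := memLp_kin_sub_line hω hl hβ γ (L := N + M) (s := N - 1) (by omega) hT
  have hkb := memLp_kin_sub_line hω hl hβ γ (L := N + M) (s := N) (by omega) hT
  have ht1 : termSite N M 1 = N - 1 := rfl
  have ht2 : termSite N M 2 = N := rfl
  have hγ2 : γ ^ 2 ≠ 0 := pow_ne_zero 2 hγ.ne'
  have hT2 : T ^ 2 ≠ 0 := pow_ne_zero 2 hT.ne'
  constructor
  · have e : (fun x => gb₁ x * ((kin (N + M) (N - 1) x - T) + (kin (N + M) N x - T))) =
        fun x => gb₁ x * (kin (N + M) (N - 1) x - T) + gb₁ x * (kin (N + M) N x - T) := by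
      funext x; ring
    have Ia : Integrable (fun x => gb₁ x * (kin (N + M) (N - 1) x - T)) μ := h1L2.integrable_mul hka
    have Ib : Integrable (fun x => gb₁ x * (kin (N + M) N x - T)) μ := h1L2.integrable_mul hkb
    rw [e, integral_add Ia Ib]
    have g1 := hK1 1 (by decide)
    have g2 := hK1 2 (by decide)
    rw [ht1, hPγ] at g1
    rw [ht2, hPγ] at g2
    unfold transferLeft
    rw [g1, g2]
    field_simp
  · have e : (fun x => gb₄ x * ((kin (N + M) (N - 1) x - T) + (kin (N + M) N x - T))) =
        fun x => gb₄ x * (kin (N + M) (N - 1) x - T) + gb₄ x * (kin (N + M) N x - T) := by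
      funext x; ring
    have Ia : Integrable (fun x => gb₄ x * (kin (N + M) (N - 1) x - T)) μ := h4L2.integrable_mul hka
    have Ib : Integrable (fun x => gb₄ x * (kin (N + M) N x - T)) μ := h4L2.integrable_mul hkb
    rw [e, integral_add Ia Ib]
    have g1 := hK4 1 (by decide)
    have g2 := hK4 2 (by decide)
    rw [ht1, hPγ] at g1
    rw [ht2, hPγ] at g2
    unfold transferRight
    rw [hsym 1 3, hsym 2 3, g1, g2]
    field_simp

/-- **ENERGY CHANNEL OF THE PROBED END FIELDS (registered helper; fixed `N`, `M`; exact; both ends).** Under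
`KuboFrame P T N M g gb₁ gb₄` (`P = pinnedChain ω₂ lam β γ`, `ω₂, γ, T > 0`, `lam, β ≥ 0`, `N, M ≥ 1`):

  `curvature gb₁ = T²·(transferLeft g)²/γ⁴ + curvature (gb₁ − (T²·transferLeft g/(2γ²))·e_K)`,
  `curvature gb₄ = T²·(transferRight g)²/γ⁴ + curvature (gb₄ − (T²·transferRight g/(2γ²))·e_K)`.

The first summand is the ENERGY CHANNEL (the component of `S_K gb₁` along `S_K e_K ∝ (p²_{N−1} − T) + (p²_N − T)`,
fixed by the Kubo row `u = g₀₁ + g₀₂ = (γ²/T²)⟨gb₁, φ⟩`; it is also the known floor `‖S_K gb₁‖² ≥ T²u²/γ⁴`); the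
second is the curvature of the END field corrected by the pair's local-equilibrium shift at the weight the Kubo row
dictates — the DIRECTION CHANNEL. Hence the stub `‖S_K gb₁‖² ≤ C₃ (selfLeft g)²` is EQUIVALENT to the pair of
`N`-uniform bounds `(transferLeft g)² ≤ C (selfLeft g)²` (a pure Kubo-coefficient inequality: `|bypass g − selfLeft g| ≤ √C·selfLeft g`)
and `curvature (gb₁ − (T² transferLeft g/(2γ²)) e_K) ≤ C (selfLeft g)²` (the direction channel), both sides of
which are visible in the exact Gaussian beds (energy channel `= T²(u/a)²/γ⁴ ≤ 1` of `C3 ≈ 3.8–4.4`). -/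
theorem helper_curvatureEnergyChannel : ∀ (ω₂ lam β γ T : ℝ), 0 < ω₂ → 0 ≤ lam → 0 ≤ β → 0 < γ → 0 < T → ∀ (N M : ℕ), 1 ≤ N → 1 ≤ M → ∀ (g : Fin 4 → Fin 4 → ℝ) (gb₁ gb₄ : PhaseSpace (N + M) → ℝ), KuboFrame (pinnedChain ω₂ lam β γ) T N M g gb₁ gb₄ → curvature (pinnedChain ω₂ lam β γ) T N M gb₁ = T ^ 2 * transferLeft g ^ 2 / γ ^ 4 + curvature (pinnedChain ω₂ lam β γ) T N M (fun x => gb₁ x - T ^ 2 * transferLeft g / (2 * γ ^ 2) * eK T N M x) ∧ curvature (pinnedChain ω₂ lam β γ) T N M gb₄ = T ^ 2 * transferRight g ^ 2 / γ ^ 4 + curvature (pinnedChain ω₂ lam β γ) T N M (fun x => gb₄ x - T ^ 2 * transferRight g / (2 * γ ^ 2) * eK T N M x) := by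
  intro ω₂ lam β γ T hω hl hβ hγ hT N M hN hM g gb₁ gb₄ hKF
  obtain ⟨hJ1, hJ4⟩ := kuboFrame_pairPairing hω hl hβ hγ hT hN hM hKF
  obtain ⟨-, -, hff1, hff4, -, -, -, -⟩ := hKF
  obtain ⟨h1C, h1L2, h1S, -, -⟩ := hff1
  obtain ⟨h4C, h4L2, h4S, -, -⟩ := hff4
  have hγ2 : γ ^ 2 ≠ 0 := pow_ne_zero 2 hγ.ne'
  have hT2 : T ^ 2 ≠ 0 := pow_ne_zero 2 hT.ne'
  have c1 := curvature_eq_energyChannel_add hω hl hβ γ hT hN hM h1C h1L2 h1S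
  have c4 := curvature_eq_energyChannel_add hω hl hβ γ hT hN hM h4C h4L2 h4S
  rw [hJ1] at c1
  rw [hJ4] at c4
  have e1 : (fun x => gb₁ x - T ^ 2 / γ ^ 2 * transferLeft g / 2 * eK T N M x) =
      fun x => gb₁ x - T ^ 2 * transferLeft g / (2 * γ ^ 2) * eK T N M x := by
    funext x; field_simp
  have e4 : (fun x => gb₄ x - T ^ 2 / γ ^ 2 * transferRight g / 2 * eK T N M x) =
      fun x => gb₄ x - T ^ 2 * transferRight g / (2 * γ ^ 2) * eK T N M x := by
    funext x; field_simp
  rw [e1] at c1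
  rw [e4] at c4
  have s1 : (T ^ 2 / γ ^ 2 * transferLeft g) ^ 2 / T ^ 2 = T ^ 2 * transferLeft g ^ 2 / γ ^ 4 := by
    field_simp
  have s4 : (T ^ 2 / γ ^ 2 * transferRight g) ^ 2 / T ^ 2 = T ^ 2 * transferRight g ^ 2 / γ ^ 4 := by
    field_simp
  rw [s1] at c1
  rw [s4] at c4
  exact ⟨c1, c4⟩

/-- **Corollary (the floor, both ends)**: `T²(transferLeft g)²/γ⁴ ≤ curvature gb₁` and
`T²(transferRight g)²/γ⁴ ≤ curvature gb₄` under `KuboFrame`; in particular the stub forces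
`(transferLeft g)² ≤ (C₃γ⁴/T²)(selfLeft g)²`. -/
theorem energyChannel_le_curvature_of_kuboFrame {ω₂ lam β γ T : ℝ} (hω : 0 < ω₂) (hl : 0 ≤ lam) (hβ : 0 ≤ β)
    (hγ : 0 < γ) (hT : 0 < T) {N M : ℕ} (hN : 1 ≤ N) (hM : 1 ≤ M) {g : Fin 4 → Fin 4 → ℝ}
    {gb₁ gb₄ : PhaseSpace (N + M) → ℝ} (hKF : KuboFrame (pinnedChain ω₂ lam β γ) T N M g gb₁ gb₄) :
    T ^ 2 * transferLeft g ^ 2 / γ ^ 4 ≤ curvature (pinnedChain ω₂ lam β γ) T N M gb₁ ∧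
    T ^ 2 * transferRight g ^ 2 / γ ^ 4 ≤ curvature (pinnedChain ω₂ lam β γ) T N M gb₄ := by
  obtain ⟨c1, c4⟩ := helper_curvatureEnergyChannel ω₂ lam β γ T hω hl hβ hγ hT N M hN hM g gb₁ gb₄ hKF
  have n1 : 0 ≤ curvature (pinnedChain ω₂ lam β γ) T N M
      (fun x => gb₁ x - T ^ 2 * transferLeft g / (2 * γ ^ 2) * eK T N M x) := integral_nonneg fun _ => sq_nonneg _
  have n4 : 0 ≤ curvature (pinnedChain ω₂ lam β γ) T N M
      (fun x => gb₄ x - T ^ 2 * transferRight g / (2 * γ ^ 2) * eK T N M x) := integral_nonneg fun _ => sq_nonneg _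
  constructor <;> linarith

end EnergyChannel

section Reduction

/-- **REDUCTION OF THE STUB TO THE TWO CHANNEL BOUNDS.** If, `N`-uniformly over all Kubo frames of the γ-probed
device, (i) the junction→end transfer is dominated by the end self-conductance, `(transferLeft g)² ≤ C (selfLeft g)²`
(equivalently `|selfLeft g − bypass g| ≤ √C selfLeft g`: a Kubo-COEFFICIENT inequality), and (ii) the DIRECTION CHANNEL
is small, `‖S_K(gb₁ − (T² transferLeft g/(2γ²)) e_K)‖² ≤ C (selfLeft g)²` (and the mirror clauses at bath 4), then
`stub_junctionCurvature` holds with `C₃ = (T²/γ⁴) C + C` (by `helper_curvatureEnergyChannel`). -/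
theorem helper_curvatureChannelReduction : ∀ (ω₂ lam β γ T : ℝ), 0 < ω₂ → 0 ≤ lam → 0 ≤ β → 0 < γ → 0 < T → ∀ (C : ℝ), (∀ (N M : ℕ), 2 ≤ N → 2 ≤ M → ∀ (g : Fin 4 → Fin 4 → ℝ) (gb₁ gb₄ : PhaseSpace (N + M) → ℝ), KuboFrame (pinnedChain ω₂ lam β γ) T N M g gb₁ gb₄ → transferLeft g ^ 2 ≤ C * selfLeft g ^ 2 ∧ curvature (pinnedChain ω₂ lam β γ) T N M (fun x => gb₁ x - T ^ 2 * transferLeft g / (2 * γ ^ 2) * eK T N M x) ≤ C * selfLeft g ^ 2 ∧ transferRight g ^ 2 ≤ C * selfRight g ^ 2 ∧ curvature (pinnedChain ω₂ lam β γ) T N M (fun x => gb₄ x - T ^ 2 * transferRight g / (2 * γ ^ 2) * eK T N M x) ≤ C * selfRight g ^ 2) → ∀ (N M : ℕ), 2 ≤ N → 2 ≤ M → ∀ (g : Fin 4 → Fin 4 → ℝ) (gb₁ gb₄ : PhaseSpace (N + M) → ℝ), KuboFrame (pinnedChain ω₂ lam β γ) T N M g gb₁ gb₄ → curvature (pinnedChain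 ω₂ lam β γ) T N M gb₁ ≤ (T ^ 2 / γ ^ 4 * C + C) * selfLeft g ^ 2 ∧ curvature (pinnedChain ω₂ lam β γ) T N M gb₄ ≤ (T ^ 2 / γ ^ 4 * C + C) * selfRight g ^ 2 := by
  intro ω₂ lam β γ T hω hl hβ hγ hT C hB N M hN hM g gb₁ gb₄ hKF
  obtain ⟨c1, c4⟩ := helper_curvatureEnergyChannel ω₂ lam β γ T hω hl hβ hγ hT N M (by omega) (by omega) g gb₁ gb₄ hKF
  obtain ⟨u1, d1, u4, d4⟩ := hB N M hN hM g gb₁ gb₄ hKF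
  have hTγ : 0 ≤ T ^ 2 / γ ^ 4 := by positivity
  constructor
  · rw [c1]
    have : T ^ 2 * transferLeft g ^ 2 / γ ^ 4 = T ^ 2 / γ ^ 4 * transferLeft g ^ 2 := by ring
    rw [this]
    nlinarith [mul_le_mul_of_nonneg_left u1 hTγ]
  · rw [c4]
    have : T ^ 2 * transferRight g ^ 2 / γ ^ 4 = T ^ 2 / γ ^ 4 * transferRight g ^ 2 := by ring
    rw [this]
    nlinarith [mul_le_mul_of_nonneg_left u4 hTγ]

/-- **CONVERSELY, the stub implies both channel bounds** (with constants `γ⁴C₃/T²` and `C₃`): the reduction above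
loses nothing, so `stub_junctionCurvature` is EQUIVALENT, frame by frame, to the conjunction of the Kubo-coefficient
inequality `(transferLeft g)² ≤ C (selfLeft g)²` and the direction-channel bound (and their mirrors). -/
theorem channelBounds_of_stub_junctionCurvature : ∀ (ω₂ lam β γ T : ℝ), 0 < ω₂ → 0 ≤ lam → 0 ≤ β → 0 < γ → 0 < T → ∀ (C₃ : ℝ) (N M : ℕ), 2 ≤ N → 2 ≤ M → ∀ (g : Fin 4 → Fin 4 → ℝ) (gb₁ gb₄ : PhaseSpace (N + M) → ℝ), KuboFrame (pinnedChain ω₂ lam β γ) T N M g gb₁ gb₄ → curvature (pinnedChain ω₂ lam β γ) T N M gb₁ ≤ C₃ * selfLeft g ^ 2 → curvature (pinnedChain ω₂ lam β γ) T N M gb₄ ≤ C₃ * selfRight g ^ 2 → transferLeft g ^ 2 ≤ γ ^ 4 / T ^ 2 * C₃ * selfLeft g ^ 2 ∧ curvature (pinnedChain ω₂ lam β γ) T N M (fun x => gb₁ x - T ^ 2 * transferLeft g / (2 * γ ^ 2) * eK T N M x) ≤ C₃ * selfLeft g ^ 2 ∧ transferRight g ^ 2 ≤ γ ^ 4 /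 T ^ 2 * C₃ * selfRight g ^ 2 ∧ curvature (pinnedChain ω₂ lam β γ) T N M (fun x => gb₄ x - T ^ 2 * transferRight g / (2 * γ ^ 2) * eK T N M x) ≤ C₃ * selfRight g ^ 2 := by
  intro ω₂ lam β γ T hω hl hβ hγ hT C₃ N M hN hM g gb₁ gb₄ hKF h1 h4
  obtain ⟨c1, c4⟩ := helper_curvatureEnergyChannel ω₂ lam β γ T hω hl hβ hγ hT N M (by omega) (by omega) g gb₁ gb₄ hKF
  have n1 : 0 ≤ curvature (pinnedChain ω₂ lam β γ) T N M
      (fun x => gb₁ x - T ^ 2 * transferLeft g / (2 * γ ^ 2) * eK T N M x) := integral_nonneg fun _ => sq_nonneg _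
  have n4 : 0 ≤ curvature (pinnedChain ω₂ lam β γ) T N M
      (fun x => gb₄ x - T ^ 2 * transferRight g / (2 * γ ^ 2) * eK T N M x) := integral_nonneg fun _ => sq_nonneg _
  have hγ4 : 0 < γ ^ 4 := by positivity
  have hT2 : 0 < T ^ 2 := by positivity
  have e1 : T ^ 2 * transferLeft g ^ 2 / γ ^ 4 ≤ C₃ * selfLeft g ^ 2 := by rw [c1] at h1; linarith
  have e4 : T ^ 2 * transferRight g ^ 2 / γ ^ 4 ≤ C₃ * selfRight g ^ 2 := by rw [c4] at h4; linarith
  refine ⟨?_, ?_, ?_, ?_⟩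
  · have := mul_le_mul_of_nonneg_left e1 (by positivity : (0 : ℝ) ≤ γ ^ 4 / T ^ 2)
    have e : γ ^ 4 / T ^ 2 * (T ^ 2 * transferLeft g ^ 2 / γ ^ 4) = transferLeft g ^ 2 := by
      field_simp
    rw [e] at this
    linarith
  · rw [c1] at h1
    have : 0 ≤ T ^ 2 * transferLeft g ^ 2 / γ ^ 4 := by positivity
    linarith
  · have := mul_le_mul_of_nonneg_left e4 (by positivity : (0 : ℝ) ≤ γ ^ 4 / T ^ 2)
    have e : γ ^ 4 / T ^ 2 * (T ^ 2 * transferRight g ^ 2 / γ ^ 4) = transferRight g ^ 2 := by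
      field_simp
    rw [e] at this
    linarith
  · rw [c4] at h4
    have : 0 ≤ T ^ 2 * transferRight g ^ 2 / γ ^ 4 := by positivity
    linarith

end Reduction

end Summit.AtomisticToContinuum.FouriersLaw.Cruxes.SuperadditiveResistance.ThermaliseThenCutProbeInsertion

end
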